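import Mathlib

/-!
# HOME DRAFT — TN-GR (GR-a) infrastructure: «H-clause + anchored gradient ⇒ first differences along a path» (abstract telescoping)

`CURRENCY-MEMO-g26.md` v2.2 §10.3 (GR-a); critic idea-crit-5 #570 (A) («elementary and ADMISSIBLE; its price is N(U)»).
Abstract setting: configurations `X`, bonds `ι`, moves `M` with a size `sz : M → ℝ`, an action `act U b m` (apply move `m` at bond `b`).
* `applyPath act U₀ path` — apply a list of (bond, move) pairs successively.
* `firstDiff_telescope` — if `f` satisfies the (abstract) SCALED PAIR CLAUSE `|f(act (act U b m) b′ m′) − f(act U b m) − f(act U b′ m′) + f U| ≤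
  k b b′ · sz m · sz m′` for all `U` (same-bond squares included: first move `m` at `b`, then `m′` at `b′ = b`), and its first differences AT THE START
  `U₀` are bounded by `G b · sz m`, then at the END of any path they are bounded by `(G b + Σ_{(bᵢ, mᵢ) ∈ path} k bᵢ b · sz mᵢ) · sz m` — the anchor
  letter plus PATH LENGTH × column mass of `k`, exactly the N(U) price named by the critic.
The WINDOWED form (`firstDiff_step_on`, ★`firstDiff_telescope_on`: clause only on a window `Good` with move-size cap `ρ`, path prefixes and
their `b`-excitations in the window) is the shape the organ instantiates with `act U b v := update U b (U b * expPt v)`, `Good := PlaqSmall θ`,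
`sz v := ‖v‖/θ`, `ρ := r`; the anchor letter is `G = 0` at the flat configuration (`GRFlatEven.flatGradient_zero`, (GR-b′)).  HONEST: abstract real-analysis bookkeeping; nothing about the runs; nothing of O1∕O1ᵘ-H∕S3∕20520∕
`YM3TorusSU2` is proved; R3 = SU(2) YM₃ on T³ — NOT d = 4, NOT infinite volume, NOT a mass gap, NOT Clay.
-/

namespace Summit.QuantumFields.YangMills.Cruxes.FluctuationComparisonRegPrIntL.GRTelescope

variable {X ι M : Type*}

/-- Apply the (bond, move) pairs of `path` successively, starting from `U`. -/
def applyPath (act : X → ι → M → X) (U : X) (path : List (ι × M)) : X :=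
  path.foldl (fun V p => act V p.1 p.2) U

theorem applyPath_nil (act : X → ι → M → X) (U : X) : applyPath act U [] = U := rfl

theorem applyPath_cons (act : X → ι → M → X) (U : X) (p : ι × M) (ps : List (ι × M)) :
    applyPath act U (p :: ps) = applyPath act (act U p.1 p.2) ps := rfl

/-- ONE STEP: the scaled pair clause moves a first-difference bound across one move, at the cost of one column entry of `k`. -/
theorem firstDiff_step (act : X → ι → M → X) (sz : M → ℝ) (f : X → ℝ) (k : ι → ι → ℝ)
    (hH : ∀ (U : X) (b b' : ι) (m m' : M),
      |f (act (act U b m) b' m') - f (act U b m) - f (act U b' m') + f U| ≤ k b b' * sz m * sz m')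
    (U₀ : X) (G : ι → ℝ) (hG : ∀ b m, |f (act U₀ b m) - f U₀| ≤ G b * sz m) (p : ι × M) :
    ∀ b m, |f (act (act U₀ p.1 p.2) b m) - f (act U₀ p.1 p.2)| ≤ (G b + k p.1 b * sz p.2) * sz m := by
  intro b m
  have h1 := hH U₀ p.1 b p.2 m
  have h2 := hG b m
  have hsplit : f (act (act U₀ p.1 p.2) b m) - f (act U₀ p.1 p.2)
      = (f (act U₀ b m) - f U₀) + (f (act (act U₀ p.1 p.2) b m) - f (act U₀ p.1 p.2) - f (act U₀ b m) + f U₀) := by ring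
  rw [hsplit]
  calc |(f (act U₀ b m) - f U₀) + (f (act (act U₀ p.1 p.2) b m) - f (act U₀ p.1 p.2) - f (act U₀ b m) + f U₀)|
        ≤ |f (act U₀ b m) - f U₀| + |f (act (act U₀ p.1 p.2) b m) - f (act U₀ p.1 p.2) - f (act U₀ b m) + f U₀| := abs_add_le _ _
    _ ≤ G b * sz m + k p.1 b * sz p.2 * sz m := add_le_add h2 h1
    _ = (G b + k p.1 b * sz p.2) * sz m := by ring

/-- ★ TELESCOPING ALONG A PATH: anchor letters `G` at the start, plus path length × column mass of `k`, bound the first differences at the end. -/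
theorem firstDiff_telescope (act : X → ι → M → X) (sz : M → ℝ) (f : X → ℝ) (k : ι → ι → ℝ)
    (hH : ∀ (U : X) (b b' : ι) (m m' : M),
      |f (act (act U b m) b' m') - f (act U b m) - f (act U b' m') + f U| ≤ k b b' * sz m * sz m') :
    ∀ (path : List (ι × M)) (U₀ : X) (G : ι → ℝ),
      (∀ b m, |f (act U₀ b m) - f U₀| ≤ G b * sz m) →
      ∀ b m, |f (act (applyPath act U₀ path) b m) - f (applyPath act U₀ path)|
        ≤ (G b + (path.map (fun p => k p.1 b * sz p.2)).sum) * sz m := by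
  intro path
  induction path with
  | nil =>
    intro U₀ G hG b m
    simpa [applyPath] using hG b m
  | cons p ps ih =>
    intro U₀ G hG b m
    have hstart := firstDiff_step act sz f k hH U₀ G hG p
    have h := ih (act U₀ p.1 p.2) (fun b => G b + k p.1 b * sz p.2) hstart b m
    rw [applyPath_cons]
    simpa [List.map_cons, List.sum_cons, add_assoc] using h

/-- The ANCHORED form of (GR-a): anchor at `U₀` with letters `g⁰`, any path; the end-point first differences are bounded by
`(g⁰ b + N · κ_b) · sz m` whenever every step's column entry is `≤ κ_b` (e.g. `κ_b = Σ_{b′} k b′ b` for `k ≥ 0`) and the path has length `N`. -/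
theorem firstDiff_of_anchor_and_length (act : X → ι → M → X) (sz : M → ℝ) (f : X → ℝ) (k : ι → ι → ℝ)
    (hH : ∀ (U : X) (b b' : ι) (m m' : M),
      |f (act (act U b m) b' m') - f (act U b m) - f (act U b' m') + f U| ≤ k b b' * sz m * sz m')
    (U₀ : X) (g₀ : ι → ℝ) (hg : ∀ b m, |f (act U₀ b m) - f U₀| ≤ g₀ b * sz m)
    (path : List (ι × M)) (b : ι) (κb : ℝ) (hκ : ∀ p ∈ path, k p.1 b * sz p.2 ≤ κb)
    (m : M) (hm : 0 ≤ sz m) :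
    |f (act (applyPath act U₀ path) b m) - f (applyPath act U₀ path)| ≤ (g₀ b + path.length * κb) * sz m := by
  have h := firstDiff_telescope act sz f k hH path U₀ g₀ hg b m
  have hsum : (path.map (fun p => k p.1 b * sz p.2)).sum ≤ path.length * κb := by
    have := List.sum_le_card_nsmul (path.map (fun p => k p.1 b * sz p.2)) κb (by
      intro x hx
      obtain ⟨p, hp, rfl⟩ := List.mem_map.1 hx
      exact hκ p hp)
    simpa [List.length_map, nsmul_eq_mul] using this
  calc |f (act (applyPath act U₀ path) b m) - f (applyPath act U₀ path)|
        ≤ (g₀ b + (path.map (fun p => k p.1 b * sz p.2)).sum) * sz m := h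
    _ ≤ (g₀ b + path.length * κb) * sz m := by
        apply mul_le_mul_of_nonneg_right _ hm
        linarith

/-! ## Windowed form (the organ's clause holds only on the small-field window and for window-size moves)

`Good : X → Prop` is the window, `ρ` the move-size cap.  The clause is assumed only when all four corners of the square are `Good` and both moves
have size `≤ ρ`; the path hypotheses say every prefix configuration and its `b`-excitation stay `Good` and every move is window-size. -/

/-- ONE WINDOWED STEP. -/
theorem firstDiff_step_on (Good : X → Prop) (ρ : ℝ) (act : X → ι → M → X) (sz : M → ℝ) (f : X → ℝ) (k : ι → ι → ℝ)
    (hH : ∀ (U : X) (b b' : ι) (m m' : M), Good U → Good (act U b m) → Good (act U b' m') → Good (act (act U b m) b' m') →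
      sz m ≤ ρ → sz m' ≤ ρ → |f (act (act U b m) b' m') - f (act U b m) - f (act U b' m') + f U| ≤ k b b' * sz m * sz m')
    (U₀ : X) (p : ι × M) (b : ι) (m : M)
    (hU₀ : Good U₀) (hU₁ : Good (act U₀ p.1 p.2)) (hU₀b : Good (act U₀ b m)) (hU₁b : Good (act (act U₀ p.1 p.2) b m))
    (hp : sz p.2 ≤ ρ) (hm : sz m ≤ ρ)
    (G : ℝ) (hG : |f (act U₀ b m) - f U₀| ≤ G * sz m) :
    |f (act (act U₀ p.1 p.2) b m) - f (act U₀ p.1 p.2)| ≤ (G + k p.1 b * sz p.2) * sz m := by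
  have h1 := hH U₀ p.1 b p.2 m hU₀ hU₁ hU₀b hU₁b hp hm
  have hsplit : f (act (act U₀ p.1 p.2) b m) - f (act U₀ p.1 p.2)
      = (f (act U₀ b m) - f U₀) + (f (act (act U₀ p.1 p.2) b m) - f (act U₀ p.1 p.2) - f (act U₀ b m) + f U₀) := by ring
  rw [hsplit]
  calc |(f (act U₀ b m) - f U₀) + (f (act (act U₀ p.1 p.2) b m) - f (act U₀ p.1 p.2) - f (act U₀ b m) + f U₀)|
        ≤ |f (act U₀ b m) - f U₀| + |f (act (act U₀ p.1 p.2) b m) - f (act U₀ p.1 p.2) - f (act U₀ b m) + f U₀| := abs_add_le _ _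
    _ ≤ G * sz m + k p.1 b * sz p.2 * sz m := add_le_add hG h1
    _ = (G + k p.1 b * sz p.2) * sz m := by ring

/-- ★ WINDOWED TELESCOPING: for a fixed target bond `b` and move `m`, if every prefix of the path and its `b`-excitation are `Good` and all moves are
window-size, the first difference at the end is bounded by `(G + Σ_{(bᵢ, mᵢ) ∈ path} k bᵢ b · sz mᵢ) · sz m`, `G` the anchor letter at `U₀`. -/
theorem firstDiff_telescope_on (Good : X → Prop) (ρ : ℝ) (act : X → ι → M → X) (sz : M → ℝ) (f : X → ℝ) (k : ι → ι → ℝ)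
    (hH : ∀ (U : X) (b b' : ι) (m m' : M), Good U → Good (act U b m) → Good (act U b' m') → Good (act (act U b m) b' m') →
      sz m ≤ ρ → sz m' ≤ ρ → |f (act (act U b m) b' m') - f (act U b m) - f (act U b' m') + f U| ≤ k b b' * sz m * sz m')
    (b : ι) (m : M) (hm : sz m ≤ ρ) :
    ∀ (path : List (ι × M)) (U₀ : X) (G : ℝ),
      (∀ p ∈ path, sz p.2 ≤ ρ) →
      (∀ n ≤ path.length, Good (applyPath act U₀ (path.take n)) ∧ Good (act (applyPath act U₀ (path.take n)) b m)) →
      |f (act U₀ b m) - f U₀| ≤ G * sz m →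
      |f (act (applyPath act U₀ path) b m) - f (applyPath act U₀ path)|
        ≤ (G + (path.map (fun p => k p.1 b * sz p.2)).sum) * sz m := by
  intro path
  induction path with
  | nil =>
    intro U₀ G _ _ hG
    simpa [applyPath] using hG
  | cons p ps ih =>
    intro U₀ G hsz hgood hG
    have h0 := hgood 0 (Nat.zero_le _)
    have h1 := hgood 1 (by simp)
    simp only [List.take_zero, applyPath_nil] at h0
    simp only [List.take_succ_cons, List.take_zero, applyPath_cons, applyPath_nil] at h1
    have hstart := firstDiff_step_on Good ρ act sz f k hH U₀ p b m h0.1 h1.1 h0.2 h1.2 (hsz p (by simp)) hm G hG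
    have hsz' : ∀ q ∈ ps, sz q.2 ≤ ρ := fun q hq => hsz q (List.mem_cons_of_mem p hq)
    have hgood' : ∀ n ≤ ps.length, Good (applyPath act (act U₀ p.1 p.2) (ps.take n)) ∧
        Good (act (applyPath act (act U₀ p.1 p.2) (ps.take n)) b m) := by
      intro n hn
      have := hgood (n + 1) (by simpa using hn)
      simpa [List.take_succ_cons, applyPath_cons] using this
    have h := ih (act U₀ p.1 p.2) (G + k p.1 b * sz p.2) hsz' hgood' hstart
    rw [applyPath_cons]
    simpa [List.map_cons, List.sum_cons, add_assoc] using h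

end Summit.QuantumFields.YangMills.Cruxes.FluctuationComparisonRegPrIntL.GRTelescope
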